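import Mathlib
import Summits.Parity.GeneralizedHardyLittlewood.Theorems.LiouvilleShiftedTablesPairsFromMAvgMoebiusInputs

/-!
# `PairsFromMAvg`, part 1b: truncated Möbius sums `∑_{d ≤ D} (b ⋆ μ)(d) w(d)` from the prime number theorem

Route `LiouvilleShiftedTables` (Parity / GeneralizedHardyLittlewood), support item stmt-Parity-14275
(`PairsFromMAvg`). Writing `μ(d) d/φ(d) 1_{(d,h)=1} = (b ⋆ μ)(d)` with `b` multiplicative,
`b(p^k) = -1/(p-1)` (`p ∤ h`), `1` (`p ∣ h`), the three truncated singular-series sums become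
`∑_{n ≤ D} b(n) · {m, m₁, M}(D/n)` (`m(y) = ∑_{e ≤ y} μ(e)/e`, `m₁(y) = ∑ μ(e) log e/e`, `M(y) = ∑ μ(e)`).
This file proves the ABSTRACT estimates, for any real arithmetic function `b` with
`∑_{n ≤ N} |b(n)|/√n ≤ S` (split at `n² ≤ D`: PNT-strength bounds for `n ≤ √D`, tails for `n > √D`):

* `abs_sum_convMoebius_div_le` — `|∑_{d ≤ D} (b⋆μ)(d)/d| ≤ S(9C_m (log D)⁻² + K D^{-1/4})`;
* `abs_sum_convMoebius_le` — `|∑_{d ≤ D} (b⋆μ)(d)| ≤ S(9C_M D (log D)⁻² + D^{3/4})`;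
* `abs_sum_convMoebius_log_div_add_le` —
  `|∑_{d ≤ D} (b⋆μ)(d) log d/d + ∑_{n ≤ D} b(n)/n| ≤ S(27(C_m+C₁)(log D)⁻² + 5(K+K₁) D^{-1/8})`.

[folklore; cite: MontgomeryVaughan2007, §8.1; GoldstonYildirim2001, Lemma 2.1]
-/

noncomputable section

open Finset Real ArithmeticFunction Filter
open scoped ArithmeticFunction.Moebius ArithmeticFunction.zeta

namespace Summit.Parity.GeneralizedHardyLittlewood.Theorems.PairsFromMAvg

/-! ### The three abstract estimates -/

/-- **`∑_{d ≤ D} (b ⋆ μ)(d)/d ≪ S/(log D)²`**: with `m(y) = ∑_{e ≤ y} μ(e)/e`,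
`∑_{d ≤ D} (b⋆μ)(d)/d = ∑_{n ≤ D} (b(n)/n) m(D/n)`; for `n ≤ √D` use `m(D/n) ≪ (log D)⁻²`, for
`n > √D` use `|m| ≤ K` and `1/n ≤ D^{-1/4}/√n`. [folklore] -/
theorem abs_sum_convMoebius_div_le (b : ArithmeticFunction ℝ) {S K Cm : ℝ}
    (hS : ∀ N, ∑ n ∈ Icc 1 N, |b n| / Real.sqrt n ≤ S)
    (hK : ∀ n : ℕ, |∑ k ∈ Icc 1 n, (μ k : ℝ) / k| ≤ K) (hCm0 : 0 ≤ Cm)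
    (hCm : ∀ n : ℕ, 2 ≤ n → |∑ k ∈ Icc 1 n, (μ k : ℝ) / k| ≤ Cm / Real.log n ^ 2)
    {D : ℕ} (hD : 64 ≤ D) :
    |∑ d ∈ Icc 1 D, (b * (μ : ArithmeticFunction ℝ)) d / d| ≤
      S * (9 * Cm / Real.log D ^ 2) + S * (K * (D : ℝ) ^ (-(1 / 4 : ℝ))) := by
  have hK0 : 0 ≤ K := (abs_nonneg _).trans (hK 0)
  have hD0 : 0 < D := by omega
  have hDr : (0 : ℝ) < D := by exact_mod_cast hD0
  set m : ℕ → ℝ := fun q => ∑ k ∈ Icc 1 q, (μ k : ℝ) / k with hm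
  have hre : ∑ d ∈ Icc 1 D, (b * (μ : ArithmeticFunction ℝ)) d / d =
      ∑ n ∈ Icc 1 D, b n / n * m (D / n) := by
    have h := sum_convMoebius_mul_eq b (fun d => 1 / (d : ℝ)) D
    simp only [mul_one_div] at h
    rw [h]
    refine Finset.sum_congr rfl fun n _ => ?_
    rw [hm, Finset.mul_sum, Finset.mul_sum]
    refine Finset.sum_congr rfl fun e _ => ?_
    push_cast
    ring
  rw [hre]
  have hlogD : 0 < Real.log D := Real.log_pos (by exact_mod_cast (by omega : 1 < D))
  -- termwise bounds
  have hA : ∀ n ∈ (Icc 1 D).filter (fun n => n * n ≤ D),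
      |b n / n * m (D / n)| ≤ |b n| / Real.sqrt n * (9 * Cm / Real.log D ^ 2) := by
    intro n hn
    obtain ⟨hn, hnD⟩ := Finset.mem_filter.mp hn
    have hn1 : 1 ≤ n := (Finset.mem_Icc.mp hn).1
    have hn0 : (0 : ℝ) < n := by exact_mod_cast hn1
    obtain ⟨hq2, hlog⟩ := two_le_div_and_log_le hn1 hnD hD
    have hlq : 0 < Real.log (D / n : ℕ) :=
      Real.log_pos (by exact_mod_cast (by omega : 1 < D / n))
    have hmq : |m (D / n)| ≤ 9 * Cm / Real.log D ^ 2 := by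
      calc |m (D / n)| ≤ Cm / Real.log (D / n : ℕ) ^ 2 := hCm _ hq2
        _ ≤ Cm / (Real.log D / 3) ^ 2 := by
            gcongr
            linarith
        _ = 9 * Cm / Real.log D ^ 2 := by field_simp; ring
    rw [abs_mul, abs_div, Nat.abs_cast]
    have hsq1 : 1 ≤ Real.sqrt n := by
      rw [← Real.sqrt_one]; exact Real.sqrt_le_sqrt (by exact_mod_cast hn1)
    have hsqn : Real.sqrt n ≤ n := by
      calc Real.sqrt n = Real.sqrt n * 1 := (mul_one _).symm
        _ ≤ Real.sqrt n * Real.sqrt n := by gcongr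
        _ = n := Real.mul_self_sqrt hn0.le
    have h1n : |b n| / n ≤ |b n| / Real.sqrt n :=
      div_le_div_of_nonneg_left (abs_nonneg _) (by positivity) hsqn
    exact mul_le_mul h1n hmq (abs_nonneg _) (div_nonneg (abs_nonneg _) (Real.sqrt_nonneg _))
  have hB : ∀ n ∈ (Icc 1 D).filter (fun n => ¬ n * n ≤ D),
      |b n / n * m (D / n)| ≤ |b n| / Real.sqrt n * (K * (D : ℝ) ^ (-(1 / 4 : ℝ))) := by
    intro n hn
    obtain ⟨hn, hnD⟩ := Finset.mem_filter.mp hn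
    have hn1 : 1 ≤ n := (Finset.mem_Icc.mp hn).1
    have h1 := one_div_le_rpow_div_sqrt hn1 hD0 (not_le.mp hnD)
    rw [abs_mul, abs_div, Nat.abs_cast]
    calc |b n| / n * |m (D / n)| = |b n| * (1 / n) * |m (D / n)| := by rw [mul_one_div]
      _ ≤ |b n| * ((D : ℝ) ^ (-(1 / 4 : ℝ)) / Real.sqrt n) * K := by
          gcongr
          exact hK _
      _ = |b n| / Real.sqrt n * (K * (D : ℝ) ^ (-(1 / 4 : ℝ))) := by ring
  calc |∑ n ∈ Icc 1 D, b n / n * m (D / n)| ≤ ∑ n ∈ Icc 1 D, |b n / n * m (D / n)| :=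
        abs_sum_le_sum_abs _ _
    _ = ∑ n ∈ (Icc 1 D).filter (fun n => n * n ≤ D), |b n / n * m (D / n)| +
          ∑ n ∈ (Icc 1 D).filter (fun n => ¬ n * n ≤ D), |b n / n * m (D / n)| :=
        (Finset.sum_filter_add_sum_filter_not _ _ _).symm
    _ ≤ ∑ n ∈ (Icc 1 D).filter (fun n => n * n ≤ D), |b n| / Real.sqrt n * (9 * Cm / Real.log D ^ 2) +
          ∑ n ∈ (Icc 1 D).filter (fun n => ¬ n * n ≤ D),
            |b n| / Real.sqrt n * (K * (D : ℝ) ^ (-(1 / 4 : ℝ))) :=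
        add_le_add (Finset.sum_le_sum hA) (Finset.sum_le_sum hB)
    _ ≤ S * (9 * Cm / Real.log D ^ 2) + S * (K * (D : ℝ) ^ (-(1 / 4 : ℝ))) :=
        add_le_add (sum_filter_abs_div_sqrt_mul_le b hS D _ (by positivity))
          (sum_filter_abs_div_sqrt_mul_le b hS D _ (by positivity))

/-- **`∑_{d ≤ D} (b ⋆ μ)(d) ≪ S D/(log D)²`**: with `M(y) = ∑_{e ≤ y} μ(e)`,
`∑_{d ≤ D} (b⋆μ)(d) = ∑_{n ≤ D} b(n) M(D/n)`; for `n ≤ √D` use `M(y) ≪ y(log y)⁻²`, for `n > √D`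
use `|M(y)| ≤ y` and `1/n ≤ D^{-1/4}/√n`. [folklore] -/
theorem abs_sum_convMoebius_le (b : ArithmeticFunction ℝ) {S CM : ℝ}
    (hS : ∀ N, ∑ n ∈ Icc 1 N, |b n| / Real.sqrt n ≤ S) (hCM0 : 0 ≤ CM)
    (hCM : ∀ n : ℕ, 2 ≤ n → |∑ k ∈ Icc 1 n, (μ k : ℝ)| ≤ CM * n / Real.log n ^ 2)
    {D : ℕ} (hD : 64 ≤ D) :
    |∑ d ∈ Icc 1 D, (b * (μ : ArithmeticFunction ℝ)) d| ≤
      S * (9 * CM * D / Real.log D ^ 2) + S * ((D : ℝ) * (D : ℝ) ^ (-(1 / 4 : ℝ))) := by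
  have hD0 : 0 < D := by omega
  have hDr : (0 : ℝ) < D := by exact_mod_cast hD0
  set M : ℕ → ℝ := fun q => ∑ k ∈ Icc 1 q, (μ k : ℝ) with hM
  have hre : ∑ d ∈ Icc 1 D, (b * (μ : ArithmeticFunction ℝ)) d =
      ∑ n ∈ Icc 1 D, b n * M (D / n) := by
    have h := sum_convMoebius_mul_eq b (fun _ => (1 : ℝ)) D
    simp only [mul_one] at h
    rw [h]
  rw [hre]
  have hlogD : 0 < Real.log D := Real.log_pos (by exact_mod_cast (by omega : 1 < D))
  -- `q = ⌊D/n⌋ ≤ D/n`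
  have hqle : ∀ n : ℕ, 1 ≤ n → ((D / n : ℕ) : ℝ) ≤ D * (1 / n) := by
    intro n hn
    rw [mul_one_div]
    exact Nat.cast_div_le
  have hA : ∀ n ∈ (Icc 1 D).filter (fun n => n * n ≤ D),
      |b n * M (D / n)| ≤ |b n| / Real.sqrt n * (9 * CM * D / Real.log D ^ 2) := by
    intro n hn
    obtain ⟨hn, hnD⟩ := Finset.mem_filter.mp hn
    have hn1 : 1 ≤ n := (Finset.mem_Icc.mp hn).1
    have hn0 : (0 : ℝ) < n := by exact_mod_cast hn1
    obtain ⟨hq2, hlog⟩ := two_le_div_and_log_le hn1 hnD hD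
    have hlq : 0 < Real.log (D / n : ℕ) :=
      Real.log_pos (by exact_mod_cast (by omega : 1 < D / n))
    have hMq : |M (D / n)| ≤ (1 / n) * (9 * CM * D / Real.log D ^ 2) := by
      calc |M (D / n)| ≤ CM * (D / n : ℕ) / Real.log (D / n : ℕ) ^ 2 := hCM _ hq2
        _ ≤ CM * (D * (1 / n)) / (Real.log D / 3) ^ 2 := by
            gcongr
            · exact hqle n hn1
            · linarith
        _ = (1 / n) * (9 * CM * D / Real.log D ^ 2) := by field_simp; ring
    rw [abs_mul]
    have hsq1 : 1 ≤ Real.sqrt n := by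
      rw [← Real.sqrt_one]; exact Real.sqrt_le_sqrt (by exact_mod_cast hn1)
    have hsqn : Real.sqrt n ≤ n := by
      calc Real.sqrt n = Real.sqrt n * 1 := (mul_one _).symm
        _ ≤ Real.sqrt n * Real.sqrt n := by gcongr
        _ = n := Real.mul_self_sqrt hn0.le
    have h1n : (1 : ℝ) / n ≤ 1 / Real.sqrt n :=
      div_le_div_of_nonneg_left zero_le_one (by positivity) hsqn
    calc |b n| * |M (D / n)| ≤ |b n| * ((1 / n) * (9 * CM * D / Real.log D ^ 2)) :=
          mul_le_mul_of_nonneg_left hMq (abs_nonneg _)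
      _ ≤ |b n| * ((1 / Real.sqrt n) * (9 * CM * D / Real.log D ^ 2)) := by gcongr
      _ = |b n| / Real.sqrt n * (9 * CM * D / Real.log D ^ 2) := by ring
  have hB : ∀ n ∈ (Icc 1 D).filter (fun n => ¬ n * n ≤ D),
      |b n * M (D / n)| ≤ |b n| / Real.sqrt n * ((D : ℝ) * (D : ℝ) ^ (-(1 / 4 : ℝ))) := by
    intro n hn
    obtain ⟨hn, hnD⟩ := Finset.mem_filter.mp hn
    have hn1 : 1 ≤ n := (Finset.mem_Icc.mp hn).1
    have h1 := one_div_le_rpow_div_sqrt hn1 hD0 (not_le.mp hnD)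
    rw [abs_mul]
    calc |b n| * |M (D / n)| ≤ |b n| * (D / n : ℕ) :=
          mul_le_mul_of_nonneg_left (abs_sum_moebius_le_self _) (abs_nonneg _)
      _ ≤ |b n| * (D * (1 / n)) := mul_le_mul_of_nonneg_left (hqle n hn1) (abs_nonneg _)
      _ ≤ |b n| * (D * ((D : ℝ) ^ (-(1 / 4 : ℝ)) / Real.sqrt n)) := by gcongr
      _ = |b n| / Real.sqrt n * ((D : ℝ) * (D : ℝ) ^ (-(1 / 4 : ℝ))) := by ring
  calc |∑ n ∈ Icc 1 D, b n * M (D / n)| ≤ ∑ n ∈ Icc 1 D, |b n * M (D / n)| :=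
        abs_sum_le_sum_abs _ _
    _ = ∑ n ∈ (Icc 1 D).filter (fun n => n * n ≤ D), |b n * M (D / n)| +
          ∑ n ∈ (Icc 1 D).filter (fun n => ¬ n * n ≤ D), |b n * M (D / n)| :=
        (Finset.sum_filter_add_sum_filter_not _ _ _).symm
    _ ≤ ∑ n ∈ (Icc 1 D).filter (fun n => n * n ≤ D),
            |b n| / Real.sqrt n * (9 * CM * D / Real.log D ^ 2) +
          ∑ n ∈ (Icc 1 D).filter (fun n => ¬ n * n ≤ D),
            |b n| / Real.sqrt n * ((D : ℝ) * (D : ℝ) ^ (-(1 / 4 : ℝ))) :=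
        add_le_add (Finset.sum_le_sum hA) (Finset.sum_le_sum hB)
    _ ≤ S * (9 * CM * D / Real.log D ^ 2) + S * ((D : ℝ) * (D : ℝ) ^ (-(1 / 4 : ℝ))) :=
        add_le_add (sum_filter_abs_div_sqrt_mul_le b hS D _ (by positivity))
          (sum_filter_abs_div_sqrt_mul_le b hS D _ (by positivity))

/-- **`∑_{d ≤ D} (b ⋆ μ)(d) log d/d + ∑_{n ≤ D} b(n)/n → 0`**, quantitatively: with
`m₁(y) = ∑_{e ≤ y} μ(e) log e/e`, `∑_{d ≤ D} (b⋆μ)(d) log d/d = ∑_{n ≤ D} (b(n)/n)(log n · m(D/n) + m₁(D/n))`,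
and `m → 0`, `m₁ → -1` at rate `(log)⁻²`. [folklore] -/
theorem abs_sum_convMoebius_log_div_add_le (b : ArithmeticFunction ℝ) {S K K₁ Cm C₁ : ℝ}
    (hS : ∀ N, ∑ n ∈ Icc 1 N, |b n| / Real.sqrt n ≤ S)
    (hK : ∀ n : ℕ, |∑ k ∈ Icc 1 n, (μ k : ℝ) / k| ≤ K)
    (hK₁ : ∀ n : ℕ, |∑ k ∈ Icc 1 n, (μ k : ℝ) * Real.log k / k + 1| ≤ K₁)
    (hCm0 : 0 ≤ Cm) (hCm : ∀ n : ℕ, 2 ≤ n → |∑ k ∈ Icc 1 n, (μ k : ℝ) / k| ≤ Cm / Real.log n ^ 2)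
    (hC₁0 : 0 ≤ C₁)
    (hC₁ : ∀ n : ℕ, 2 ≤ n → |∑ k ∈ Icc 1 n, (μ k : ℝ) * Real.log k / k + 1| ≤ C₁ / Real.log n ^ 2)
    {D : ℕ} (hD : 64 ≤ D) :
    |∑ d ∈ Icc 1 D, (b * (μ : ArithmeticFunction ℝ)) d * Real.log d / d +
        ∑ n ∈ Icc 1 D, b n / n| ≤
      S * (27 * (Cm + C₁) / Real.log D ^ 2) + S * (5 * (K + K₁) * (D : ℝ) ^ (-(1 / 8 : ℝ))) := by
  have hK0 : 0 ≤ K := (abs_nonneg _).trans (hK 0)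
  have hK₁0 : 0 ≤ K₁ := (abs_nonneg _).trans (hK₁ 0)
  have hD0 : 0 < D := by omega
  have hDr : (0 : ℝ) < D := by exact_mod_cast hD0
  set m : ℕ → ℝ := fun q => ∑ k ∈ Icc 1 q, (μ k : ℝ) / k with hm
  set m₁ : ℕ → ℝ := fun q => ∑ k ∈ Icc 1 q, (μ k : ℝ) * Real.log k / k with hm₁
  have hre : ∑ d ∈ Icc 1 D, (b * (μ : ArithmeticFunction ℝ)) d * Real.log d / d +
      ∑ n ∈ Icc 1 D, b n / n =
      ∑ n ∈ Icc 1 D, b n / n * (Real.log n * m (D / n) + (m₁ (D / n) + 1)) := by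
    have h := sum_convMoebius_mul_eq b (fun d => Real.log d / (d : ℝ)) D
    simp only [← mul_div_assoc] at h
    rw [h, ← Finset.sum_add_distrib]
    refine Finset.sum_congr rfl fun n hn => ?_
    have hn0 : (0 : ℝ) < n := by exact_mod_cast (Finset.mem_Icc.mp hn).1
    rw [hm, hm₁, Finset.mul_sum, Finset.mul_sum]
    rw [mul_add, mul_add, mul_one, Finset.mul_sum, Finset.mul_sum, ← add_assoc,
      ← Finset.sum_add_distrib]
    congr 1
    refine Finset.sum_congr rfl fun e he => ?_
    have he0 : (0 : ℝ) < e := by exact_mod_cast (Finset.mem_Icc.mp he).1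
    push_cast
    rw [Real.log_mul hn0.ne' he0.ne']
    field_simp
  rw [hre]
  have hlogD : 0 < Real.log D := Real.log_pos (by exact_mod_cast (by omega : 1 < D))
  have hA : ∀ n ∈ (Icc 1 D).filter (fun n => n * n ≤ D),
      |b n / n * (Real.log n * m (D / n) + (m₁ (D / n) + 1))| ≤
        |b n| / Real.sqrt n * (27 * (Cm + C₁) / Real.log D ^ 2) := by
    intro n hn
    obtain ⟨hn, hnD⟩ := Finset.mem_filter.mp hn
    have hn1 : 1 ≤ n := (Finset.mem_Icc.mp hn).1
    have hn0 : (0 : ℝ) < n := by exact_mod_cast hn1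
    have hlogn : 0 ≤ Real.log n := Real.log_nonneg (by exact_mod_cast hn1)
    obtain ⟨hq2, hlog⟩ := two_le_div_and_log_le hn1 hnD hD
    have hlq : 0 < Real.log (D / n : ℕ) :=
      Real.log_pos (by exact_mod_cast (by omega : 1 < D / n))
    have hmq : |m (D / n)| ≤ 9 * (Cm + C₁) / Real.log D ^ 2 := by
      calc |m (D / n)| ≤ Cm / Real.log (D / n : ℕ) ^ 2 := hCm _ hq2
        _ ≤ (Cm + C₁) / (Real.log D / 3) ^ 2 := by
            gcongr
            · linarith
            · linarith
        _ = 9 * (Cm + C₁) / Real.log D ^ 2 := by field_simp; ring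
    have hm₁q : |m₁ (D / n) + 1| ≤ 9 * (Cm + C₁) / Real.log D ^ 2 := by
      calc |m₁ (D / n) + 1| ≤ C₁ / Real.log (D / n : ℕ) ^ 2 := hC₁ _ hq2
        _ ≤ (Cm + C₁) / (Real.log D / 3) ^ 2 := by
            gcongr
            · linarith
            · linarith
        _ = 9 * (Cm + C₁) / Real.log D ^ 2 := by field_simp; ring
    have hin : |Real.log n * m (D / n) + (m₁ (D / n) + 1)| ≤
        (Real.log n + 1) * (9 * (Cm + C₁) / Real.log D ^ 2) := by
      calc |Real.log n * m (D / n) + (m₁ (D / n) + 1)|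
          ≤ |Real.log n * m (D / n)| + |m₁ (D / n) + 1| := abs_add_le _ _
        _ = Real.log n * |m (D / n)| + |m₁ (D / n) + 1| := by
            rw [abs_mul, abs_of_nonneg hlogn]
        _ ≤ Real.log n * (9 * (Cm + C₁) / Real.log D ^ 2) + 9 * (Cm + C₁) / Real.log D ^ 2 :=
            add_le_add (mul_le_mul_of_nonneg_left hmq hlogn) hm₁q
        _ = (Real.log n + 1) * (9 * (Cm + C₁) / Real.log D ^ 2) := by ring
    rw [abs_mul, abs_div, Nat.abs_cast]
    have h3 := log_add_one_div_le hn1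
    calc |b n| / n * |Real.log n * m (D / n) + (m₁ (D / n) + 1)|
        ≤ |b n| / n * ((Real.log n + 1) * (9 * (Cm + C₁) / Real.log D ^ 2)) :=
          mul_le_mul_of_nonneg_left hin (by positivity)
      _ = |b n| * ((Real.log n + 1) / n) * (9 * (Cm + C₁) / Real.log D ^ 2) := by ring
      _ ≤ |b n| * (3 / Real.sqrt n) * (9 * (Cm + C₁) / Real.log D ^ 2) := by gcongr
      _ = |b n| / Real.sqrt n * (27 * (Cm + C₁) / Real.log D ^ 2) := by ring
  have hB : ∀ n ∈ (Icc 1 D).filter (fun n => ¬ n * n ≤ D),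
      |b n / n * (Real.log n * m (D / n) + (m₁ (D / n) + 1))| ≤
        |b n| / Real.sqrt n * (5 * (K + K₁) * (D : ℝ) ^ (-(1 / 8 : ℝ))) := by
    intro n hn
    obtain ⟨hn, hnD⟩ := Finset.mem_filter.mp hn
    have hn1 : 1 ≤ n := (Finset.mem_Icc.mp hn).1
    have hn0 : (0 : ℝ) < n := by exact_mod_cast hn1
    have hlogn : 0 ≤ Real.log n := Real.log_nonneg (by exact_mod_cast hn1)
    have h5 := log_add_one_div_le_rpow hn1 hD0 (not_le.mp hnD)
    have hin : |Real.log n * m (D / n) + (m₁ (D / n) + 1)| ≤ (Real.log n + 1) * (K + K₁) := by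
      calc |Real.log n * m (D / n) + (m₁ (D / n) + 1)|
          ≤ |Real.log n * m (D / n)| + |m₁ (D / n) + 1| := abs_add_le _ _
        _ = Real.log n * |m (D / n)| + |m₁ (D / n) + 1| := by
            rw [abs_mul, abs_of_nonneg hlogn]
        _ ≤ Real.log n * K + K₁ := add_le_add (mul_le_mul_of_nonneg_left (hK _) hlogn) (hK₁ _)
        _ ≤ (Real.log n + 1) * (K + K₁) := by nlinarith
    rw [abs_mul, abs_div, Nat.abs_cast]
    calc |b n| / n * |Real.log n * m (D / n) + (m₁ (D / n) + 1)|
        ≤ |b n| / n * ((Real.log n + 1) * (K + K₁)) :=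
          mul_le_mul_of_nonneg_left hin (by positivity)
      _ = |b n| * ((Real.log n + 1) / n) * (K + K₁) := by ring
      _ ≤ |b n| * (5 * (D : ℝ) ^ (-(1 / 8 : ℝ)) / Real.sqrt n) * (K + K₁) := by gcongr
      _ = |b n| / Real.sqrt n * (5 * (K + K₁) * (D : ℝ) ^ (-(1 / 8 : ℝ))) := by ring
  calc |∑ n ∈ Icc 1 D, b n / n * (Real.log n * m (D / n) + (m₁ (D / n) + 1))|
      ≤ ∑ n ∈ Icc 1 D, |b n / n * (Real.log n * m (D / n) + (m₁ (D / n) + 1))| :=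
        abs_sum_le_sum_abs _ _
    _ = ∑ n ∈ (Icc 1 D).filter (fun n => n * n ≤ D),
            |b n / n * (Real.log n * m (D / n) + (m₁ (D / n) + 1))| +
          ∑ n ∈ (Icc 1 D).filter (fun n => ¬ n * n ≤ D),
            |b n / n * (Real.log n * m (D / n) + (m₁ (D / n) + 1))| :=
        (Finset.sum_filter_add_sum_filter_not _ _ _).symm
    _ ≤ ∑ n ∈ (Icc 1 D).filter (fun n => n * n ≤ D),
            |b n| / Real.sqrt n * (27 * (Cm + C₁) / Real.log D ^ 2) +
          ∑ n ∈ (Icc 1 D).filter (fun n => ¬ n * n ≤ D),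
            |b n| / Real.sqrt n * (5 * (K + K₁) * (D : ℝ) ^ (-(1 / 8 : ℝ))) :=
        add_le_add (Finset.sum_le_sum hA) (Finset.sum_le_sum hB)
    _ ≤ S * (27 * (Cm + C₁) / Real.log D ^ 2) + S * (5 * (K + K₁) * (D : ℝ) ^ (-(1 / 8 : ℝ))) :=
        add_le_add (sum_filter_abs_div_sqrt_mul_le b hS D _ (by positivity))
          (sum_filter_abs_div_sqrt_mul_le b hS D _ (by positivity))

end Summit.Parity.GeneralizedHardyLittlewood.Theorems.PairsFromMAvg
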